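import Summits.BirchSwinnertonDyer.BirchSwinnertonDyer.Theorems.ErratumRoadFiveBstwDoorCrossingR
import Summits.BirchSwinnertonDyer.BirchSwinnertonDyer.Theorems.ErratumRoadFiveBdvCalibrationSplitR
import Summits.BirchSwinnertonDyer.BirchSwinnertonDyer.Theorems.ErratumRoadFiveKatoFframeValueAtomsOfFamily
import Summits.BirchSwinnertonDyer.BirchSwinnertonDyer.Theorems.ErratumRoadFiveGrossZagierDescentExact
import Summits.BirchSwinnertonDyer.BirchSwinnertonDyer.Theses.ErratumRoadFive
import Literature.NumberTheory.EllipticCurves.NonvanishingTwistsPrescribedSplittingOfHoffsteinLuoProofs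
import Literature.NumberTheory.EllipticCurves.NonvanishingTwistsHoffsteinLuoProofs
import Literature.NumberTheory.EllipticCurves.GrossZagierRationalPointPeriodProofs
import Literature.NumberTheory.QuadraticFields.ImaginaryResiduePiForm
import Summits.BirchSwinnertonDyer.Rank1Residual.X11b.BDPRouteManin
import Literature.NumberTheory.EllipticCurves.NeronIsogenyScalingHoldsProofs
import Literature.NumberTheory.EllipticCurves.PastenSpectralDegreeProofs
import Literature.NumberTheory.EllipticCurves.MordellWeilTheoremProofs
import HarnessLib

/-!
# The BSTW door for `KatoValuationIneqNonsplitAtFive` ON THE AMENDED EXPONENT R — the cores and the BY-NAME entry points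
# (crux stmt-BirchSwinnertonDyer-19715, (α2) item stmt-BirchSwinnertonDyer-33169 `ErratumRoadFive.KatoValuationIneqNonsplitAtFive`)

LEAD `bsd-line-er5-p1` g20, pen word `d2R` P1 (2026-08-31T03:03:23Z: «the composition that reaches the ν-free crux BY NAME — what
33169 r3 keys on; CHECKPOINT C-sign»).  Hosted from idea-9's door `Cruxes/KatoValuationIneqNonsplitAtFive/Lines/bstw_door.lean`
(registry r2 a6e65636170da625, §2–§3, §6) with S0′ (`stub_printedFactsHeldNonsplit`'s 9-conjunction VERBATIM) as the HYPOTHESIS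
`hS0` and `logOmega x̂` unfolded to the LEAD's `padicLogLocal W p (Point.map (Algebra.ofId ℚ ℚ_[p]) x̂)` (same term by `rfl`):
`valuationIneq_core_of_crossing` (door l.1261–1424, proof verbatim: the CORE at an ABSTRACT exponent `v`);
`valuationIneqNonsplitFamilyR_core` (the family core fed with `bstwCrossingNonsplitFamilyR` at `v′ = v(σ) + v_p(λ/(q·R·∏P_ℓ)) +
v_p φ(N)`: the door's family inequality with `+ v_p φ(N)` on the LEFT); `famValuationIneqNonsplit_of_aFlatFamR` — **C-sign in
kernel form**: the LEAD's FAMILY-LEVEL binder `hFamNonsplit` of `ErratumRoadFiveKatoFframeValueAtomsOfFamily.valuationIneqNonsplit_of_family`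
(p769350) VERBATIM, ν-FREE, from S0′ ∧ A♭-famR — `ν = v_p φ(N) ≥ 0` sits on the side of `ord_p σ` and is DROPPED (`linarith`):
booking ι_N once makes ‖X‖ smaller, `log_ω e(P_L)` more divisible, and only loosens the bound; then the BY-NAME docks
`katoValuationIneqNonsplitAtFive_of_aFlatFamR : S0′ → AFlatFamStatementR → Theses.ErratumRoadFive.KatoValuationIneqNonsplitAtFive` and
the two r3 ENTRY POINTS `katoValuationIneqNonsplitAtFive_of_stubsR` (MERGED road: S0′, S1R, S2R-family) ∕ `…_of_piecesR` (PIECES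
road: S0′, S1R, S2a-supply, S2c, S2bR) over the R glue of `ErratumRoadFiveBdvCalibrationSplitR`.  NOTHING here is unconditional:
every entry point carries S0′ (nine printed facts, by name) and the OPEN R statements as hypotheses; 33169, 19715 and every route
item stay open; typed ≠ proved; no summit statement is proved; BSD is proved for no curve.
-/

set_option autoImplicit false
-- D-0017: single-problem summit, so `Summit.BirchSwinnertonDyer.BirchSwinnertonDyer.…` repeats a namespace BY DESIGN.
set_option linter.dupNamespace false

noncomputable section

open scoped Classical NumberField TensorProduct BigOperators

namespace Summit.BirchSwinnertonDyer.BirchSwinnertonDyer.Theorems.ErratumRoadFiveBstwDoor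

open Field
open Literature.NumberTheory.GaloisRepresentations
open Literature.NumberTheory.EllipticCurves Literature.NumberTheory.EllipticCurves.Kato2004
open Literature.NumberTheory.EllipticCurves.Kato2004.EulerSystemValues
open Literature.NumberTheory.EllipticCurves.Rank1Residual
open Literature.NumberTheory.EllipticCurves.Rank1Residual.Typed
open Literature.NumberTheory.EllipticCurves.ModularForms
open Literature.NumberTheory.EllipticCurves.Castella2018
open Summit.BirchSwinnertonDyer.Rank1Residual
open Summit.BirchSwinnertonDyer.BirchSwinnertonDyer.Theorems
open Summit.BirchSwinnertonDyer.BirchSwinnertonDyer.Theorems.ErratumRoadFiveBdvCalibrationSplit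
  (CalibratorSupply CalibratorDataRealisable)
open Summit.BirchSwinnertonDyer.BirchSwinnertonDyer.Theorems.ErratumRoadFiveBdvCalibrationSplitR
open IsDedekindDomain (HeightOneSpectrum)
open CongruenceSubgroup (Gamma0)

/-! ## §1 The cores (door §3; the sorry-free helpers live in `ErratumRoadFiveBstwDoorCrossingR` §3) — S0′ as the hypothesis `hS0`
(the registered stub `stub_printedFactsHeldNonsplit`'s text verbatim) -/

section Cores

variable (hS0 : nonempty_modularParametrizationData ∧ HoffsteinLuo1997_exists_twist_L_one_ne_zero ∧
      (∀ (N : ℕ) [NeZero N] (W : WeierstrassCurve ℚ) (L : Type) [Field L] [NumberField L], gross_zagier N W L) ∧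
      modularDegree_dvd_congruenceNumber ∧ mazur_not_dvd_maninConstant_of_odd ∧
      thm32_exists_isBDPLFunction_valueAtOne ∧ castella2018Exceptional_bdpValueContinuity_trivialChar ∧
      hsieh2014_exists_anticyclotomicPAdicLFunction_unrPeriod ∧ bertoliniDarmonPrasanna2013_centralValue_reciprocity)
include hS0

/-- **Core at an ABSTRACT exponent `v`: B's rational `q = #Ш_an` and the valuation inequality `v − 2 ord_p log_ω x̂ ≤ ord_p q + ord_p Tam −
2 ord_p #tors − 1`, from S0′ ∧ B ∧ a CROSSING `hcross` of A's shape at `v`** (rev 3.7's common proof of the family core and the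
admissible core below; sorry-free modulo S0′; `ρ̄` onto and `p` non-split enter only through `hcross`).  The proof picks `L` by Hoffstein–Luo (split at `p`, at `2` and at every `ℓ ∣ N`, odd
`d_L`, `|d_L| > 4`), a datum with `p ∤ c` (Mazur + Néron scaling), the `L`-rational Heegner point through the place embedding (Darmon
Thm. 3.6), a minimal datum by well-ordering, gets `P_L` of INFINITE ORDER from B through the embedding `X11b.embAt` of a degree-one
prime above the split `p` and `log_ω x̂ ≠ 0`, takes the embedding `e` of the crossing for B, and closes the inequality by
`ord_p`-arithmetic + Ribet (a) (`ord_p m_f ≤ ord_p r_f`; with ARS Thm. 2.1 (b) = `padicValNat_congruenceNumber_eq_of_not_sq_dvd` the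
Γ₀-term would vanish — not needed for `≤`); the degenerate case `log_ω(x̂) = 0` is harmless.
[cite: GrossZagier1986, Thm. I.(7.3)] [cite: AgasheRibetStein2012, Thm. 2.1] [cite: BurungaleSkinnerTianWan2024, §6.2.1 (arXiv:2409.01350 pp. 59–60)] -/
theorem valuationIneq_core_of_crossing
    {W : WeierstrassCurve ℚ} [W.IsElliptic] [W.IsGloballyMinimal] {p : ℕ} [Fact p.Prime] [NeZero (W.conductorNorm ℤ)]
    (hX : ClassX11b W p) (h5 : 5 ≤ p)
    (h1 : W.mordellWeilRank = 1) (P : Fin W.mordellWeilRank → W.toAffine.Point) (hP : W.IsMordellWeilBasis P) (v : ℤ)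
    (hcross : ∀ (L : Type) [Field L] [NumberField L], IsImaginaryQuadratic L →
        SatisfiesHeegnerHypothesis (W.conductorNorm ℤ) L → SatisfiesHeegnerHypothesis p L →
        NumberField.discr L < -4 → Odd (NumberField.discr L) →
        (W.quadraticTwist (NumberField.discr L : ℚ)).entireLFunction 1 ≠ 0 →
      ∀ (Dt : ModularParametrizationData W (W.conductorNorm ℤ))
        (Hd : HeegnerDatum (W.conductorNorm ℤ) (NumberField.discr L)) (w₀ : NumberField.InfinitePlace L)
        (PL : (W.baseChange L).toAffine.Point),
        WeierstrassCurve.Affine.Point.map w₀.embedding.toRatAlgHom PL = heegnerPointComplex Dt Hd →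
        ¬ (p : ℤ) ∣ Dt.c → ¬ IsOfFinAddOrder PL →
      ∀ (s : ℚ) (k : ℤ),
        (Real.sqrt ((NumberField.discr L).natAbs : ℝ) : ℂ) *
            (W.quadraticTwist (NumberField.discr L : ℚ)).entireLFunction 1 = (s : ℂ) * (minusPeriod Dt.f : ℂ) →
        (Dt.c : ℝ) * minusPeriod Dt.f = k * W.imaginaryPeriodRat →
      ∀ (W' : WeierstrassCurve ℚ) [W'.IsElliptic] (D : ModularParametrizationData W' (W.conductorNorm ℤ)),
        D.f = Dt.f →
        (∀ (W'' : WeierstrassCurve ℚ) [W''.IsElliptic] (D'' : ModularParametrizationData W'' (W.conductorNorm ℤ)),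
            D''.f = D.f → D.modularDegree ≤ D''.modularDegree) →
      ∃ e : L →+* ℚ_[p], congruenceNumber Dt.f ≠ 0 ∧
        v + 1 + padicValInt p Dt.c + padicValRat p s + padicValInt p k +
            ((padicValNat p (congruenceNumber Dt.f) : ℤ) - padicValNat p D.modularDegree) =
          2 * (padicLogOmega W p e PL).valuation) :
    ∃ q : ℚ, shaAn W = (q : ℂ) ∧
      v - 2 * (padicLogLocal W p (WeierstrassCurve.Affine.Point.map (Algebra.ofId ℚ ℚ_[p]) (P (Fin.cast h1.symm 0)))).valuation ≤
        padicValRat p q + padicValNat p W.tamagawaProduct - 2 * padicValNat p W.torsionOrder - 1 := by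
  obtain ⟨hmodP, hHL, hGZ, hRibet, hMaz, -, -, -, -⟩ := hS0
  have hp : p.Prime := Fact.out
  have hp2 : p ≠ 2 := by omega
  have hmod : exists_isNewformOf := exists_isNewformOf_of_nonempty_modularParametrizationData hmodP
  have hE : WeierstrassCurve.hasEntireLFunction_rat :=
    WeierstrassCurve.hasEntireLFunction_rat_of_exists_isNewformOf hmod
  -- (1) analytic rank one (class X11b) and `w(E) = -1`
  have hr : W.analyticRank = 1 := hX.1
  have hw : W.rootNumber = -1 := by
    rcases W.rootNumber_eq_one_or with hw | hw
    · exact absurd ((WeierstrassCurve.even_analyticRank_iff_of_exists_isNewformOf hmod W).mpr hw)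
        (by rw [hr]; exact Nat.not_even_one)
    · exact hw
  -- (2) a Heegner field split at `p`, `|d_L| > 4`, odd `d_L`, `L(E^{(d_L)}, 1) ≠ 0` (Hoffstein–Luo)
  obtain ⟨L, _, _, hLq, hB4, hH, hHp, -, hodd, hLt⟩ :=
    exists_heegnerField_split_two_split_oddDiscr_twist_ne_zero_of_hoffsteinLuo hmod hHL W hw hp 4
  set d : ℤ := NumberField.discr L with hd
  have hdneg : d < 0 := IsImaginaryQuadratic.discr_neg hLq
  have hd4 : d < -4 := by omega
  have hd4sq : d % 4 = 1 ∧ Squarefree d := by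
    rcases Literature.NumberTheory.QuadraticFields.Quadratic.isFundamentalDiscriminant_discr hLq.1 with
      ⟨h4, hsq, -⟩ | ⟨h4, -, -⟩
    · exact ⟨h4, hsq⟩
    · exfalso
      exact (Int.not_even_iff_odd.mpr hodd) (even_iff_two_dvd.mpr (dvd_trans ⟨2, by norm_num⟩ h4))
  have hkr := (satisfiesHeegnerHypothesis_iff_kronecker (W.conductorNorm ℤ) L hLq.1).mp hH
  have hgcd : Int.gcd d (W.conductorNorm ℤ) = 1 :=
    int_gcd_eq_one_of_forall_jacobiSym_eq_one (by omega) fun p hp hpN hp2 ↦ (hkr p hp hpN).2 hp2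
  -- (3) a datum `Dt` of `W` with MANIN CONSTANT PRIME TO `p` (Mazur 1978 Cor. 4.1 for the optimal curve + the
  --     integral Néron scaling along the isogeny, `X11b.exists_modularParametrizationData_not_dvd`), a Heegner datum
  --     `Hd` of discriminant `d_L`, and the `L`-rational Heegner point READ THROUGH THE PLACE EMBEDDING `w₀.embedding`
  --     (Darmon Thm. 3.6, tree theorem `heegnerPointComplex_mem_range_map_holds`); Gross–Zagier over `L`
  have hpN2 : ¬ p ^ 2 ∣ W.conductorNorm ℤ := X11b.not_sq_dvd_conductorNorm_of_mult W p hX.2.2.1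
  obtain ⟨Dt, hc⟩ := X11b.exists_modularParametrizationData_not_dvd hmod hMaz
    integral_neronScaling_of_isGloballyMinimal_holds W rfl hp hp2 hpN2 hX.2.2.2
  obtain ⟨β, hβ⟩ := exists_dvd_sq_sub_discr_holds (W.conductorNorm ℤ) L hLq hH
  obtain ⟨Hd, -⟩ := nonempty_heegnerDatum_holds (W.conductorNorm ℤ) L hLq hβ
  obtain ⟨w₀⟩ := (inferInstance : Nonempty (NumberField.InfinitePlace L))
  obtain ⟨PL, hPL⟩ := heegnerPointComplex_mem_range_map_holds (W.conductorNorm ℤ) W L hLq hH Dt Hd w₀.embedding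
  have eGZ : GrossZagierFormula (W.conductorNorm ℤ) W L := hGZ _ W L hLq hH
  -- (4) Birch's `s` and the period integer `k`
  obtain ⟨s, hs⟩ := exists_rat_sqrt_mul_entireLFunction_quadraticTwist_one_eq hE W Dt.isNewformOf
    hdneg hd4sq.2 hd4sq.1 hgcd
  obtain ⟨k, hk0, hk⟩ := Dt.exists_int_maninConstant_mul_minusPeriod_eq
  -- (5) a datum of minimal degree with the same newform
  obtain ⟨W', hW', D, hDf, hmin⟩ := exists_minimal_datum Dt
  -- (5b) `P_L` has INFINITE ORDER (rev 3.5): `x̂` has infinite order (a Mordell–Weil basis), so `log_ω x̂ ≠ 0`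
  --      (`log_ω` kills only torsion on `E(ℚ_p)`, and `E(ℚ) → E(ℚ_p)` is injective); B through the embedding `embAt` of a
  --      degree-one prime above the split `p` reads `2 log P_L = n log x̂` with `n ≠ 0`, so `log P_L ≠ 0`
  have hxinf : ¬ IsOfFinAddOrder (P (Fin.cast h1.symm 0)) := not_isOfFinAddOrder_of_isMordellWeilBasis_rat hP _
  have hlogx : padicLogLocal W p (WeierstrassCurve.Affine.Point.map (Algebra.ofId ℚ ℚ_[p]) (P (Fin.cast h1.symm 0))) ≠ 0 :=
    fun h0 ↦ hxinf
    (((WeierstrassCurve.Affine.Point.map_injective (W' := W.toAffine) (f := Algebra.ofId ℚ ℚ_[p])).isOfFinAddOrder_iff).mp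
      (Summit.BirchSwinnertonDyer.BirchSwinnertonDyer.Theorems.CongruentShaFreeCutKatoKummerLogTorsion.isOfFinAddOrder_of_padicLogLocal_eq_zero
        W p h0))
  obtain ⟨𝔮, h𝔮, he1, hf1⟩ := X11b.exists_degreeOnePrime_of_splitsIn L p hLq.1 (hHp p hp dvd_rfl)
  have hinfPL : ¬ IsOfFinAddOrder PL := by
    intro htor
    obtain ⟨n₀, hn₀, -, hlg₀⟩ := GrossZagierDescentExact.grossZagierDescentExact W p hmod hr hw h1 P hP L hLq hH hd4 hodd hLt
      Dt Hd w₀.embedding PL hPL eGZ s k hs hk (X11b.embAt L p _ h𝔮 he1 hf1)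
    have h0 : padicLogOmega W p (X11b.embAt L p _ h𝔮 he1 hf1) PL = 0 := by
      rw [← X11b.R1.logOmega_eq_padicLogOmega]
      exact (X11b.R1.logOmega_eq_zero_iff W p _ PL).mpr htor
    rw [h0, mul_zero] at hlg₀
    exact (mul_ne_zero (Int.cast_ne_zero.mpr hn₀) hlogx) hlg₀.symm
  -- (6) the crossing `hcross` at the exponent `v`, through its embedding `ιp : L → ℚ_p`, and B there
  obtain ⟨ιp, hrf, hA⟩ := hcross L hLq hH hHp hd4 hodd hLt Dt Hd w₀ PL hPL hc hinfPL s k hs hk W' D hDf hmin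
  obtain ⟨n, hn0, hq, hlg⟩ := GrossZagierDescentExact.grossZagierDescentExact W p hmod hr hw h1 P hP L hLq hH hd4 hodd hLt
    Dt Hd w₀.embedding PL hPL eGZ s k hs hk ιp
  refine ⟨_, hq, ?_⟩
  -- (7) Ribet: `ord_p m_f ≤ ord_p r_f`
  have hdvd : D.modularDegree ∣ congruenceNumber D.f := hRibet W' (W.conductorNorm ℤ) D hmin
  rw [hDf] at hdvd
  have he : (padicValNat p D.modularDegree : ℤ) ≤ padicValNat p (congruenceNumber Dt.f) := by
    exact_mod_cast (padicValNat_dvd_iff_le hrf).mp (dvd_trans pow_padicValNat_dvd hdvd)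
  -- (8) `2 log ι P_L = n log x̂` ⇒ `ord_p log ι P_L ≤ ord_p n + ord_p log x̂`
  set x := P (Fin.cast h1.symm 0) with hx
  have hV : (padicLogOmega W p ιp PL).valuation ≤ padicValInt p n + (padicLogLocal W p (WeierstrassCurve.Affine.Point.map (Algebra.ofId ℚ ℚ_[p]) x)).valuation := by
    by_cases h0 : padicLogLocal W p (WeierstrassCurve.Affine.Point.map (Algebra.ofId ℚ ℚ_[p]) x) = 0
    · have hz' : padicLogOmega W p ιp PL = 0 := by
        rw [h0, mul_zero] at hlg
        exact (mul_eq_zero.mp hlg).resolve_left two_ne_zero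
      rw [hz', h0, Padic.valuation_zero, add_zero]
      positivity
    · have hn' : (n : ℚ_[p]) ≠ 0 := Int.cast_ne_zero.mpr hn0
      have hne : padicLogOmega W p ιp PL ≠ 0 := by
        intro h
        rw [h, mul_zero] at hlg
        exact (mul_ne_zero hn' h0) hlg.symm
      have h2 : ((2 : ℚ_[p])).valuation = 0 := by
        haveI : Fact (Nat.Prime 2) := ⟨Nat.prime_two⟩
        rw [Padic.valuation_ofNat, padicValNat_primes hp2, Nat.cast_zero]
      have hcong := congrArg Padic.valuation hlg
      rw [Padic.valuation_mul two_ne_zero hne, h2, zero_add, Padic.valuation_mul hn' h0,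
        Padic.valuation_intCast] at hcong
      exact hcong.le
  -- (9) `ord_p` of `q = n² #tors² / (2 c s k Tam)`
  have hcQ : (Dt.c : ℚ) ≠ 0 := Int.cast_ne_zero.mpr Dt.maninConstant_ne_zero_holds
  have hkQ : (k : ℚ) ≠ 0 := Int.cast_ne_zero.mpr hk0
  have hnQ : (n : ℚ) ≠ 0 := Int.cast_ne_zero.mpr hn0
  have htors : (W.torsionOrder : ℚ) ≠ 0 := by exact_mod_cast W.torsionOrder_pos_holds.ne'
  have hTam : (W.tamagawaProduct : ℚ) ≠ 0 := by exact_mod_cast W.tamagawaProduct_pos_holds.ne'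
  have hs0 : s ≠ 0 := by
    rintro rfl
    rw [Rat.cast_zero, zero_mul, mul_eq_zero] at hs
    rcases hs with h | h
    · have hsD : 0 < Real.sqrt (d.natAbs : ℝ) :=
        Real.sqrt_pos.mpr (by exact_mod_cast Int.natAbs_pos.mpr hdneg.ne)
      exact hsD.ne' (by exact_mod_cast h)
    · exact hLt h
  have h2Q : padicValRat p (2 : ℚ) = 0 := by
    haveI : Fact (Nat.Prime 2) := ⟨Nat.prime_two⟩
    rw [show (2 : ℚ) = ((2 : ℕ) : ℚ) by norm_num, padicValRat.of_nat, padicValNat_primes hp2, Nat.cast_zero]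
  have hvq : padicValRat p ((n : ℚ) ^ 2 * (W.torsionOrder : ℚ) ^ 2 /
      (2 * (Dt.c : ℚ) * s * (k : ℚ) * (W.tamagawaProduct : ℚ))) =
      2 * padicValInt p n + 2 * padicValNat p W.torsionOrder -
        (padicValInt p Dt.c + padicValRat p s + padicValInt p k + padicValNat p W.tamagawaProduct) := by
    rw [padicValRat.div (mul_ne_zero (pow_ne_zero 2 hnQ) (pow_ne_zero 2 htors))
        (mul_ne_zero (mul_ne_zero (mul_ne_zero (mul_ne_zero two_ne_zero hcQ) hs0) hkQ) hTam),
      padicValRat.mul (pow_ne_zero 2 hnQ) (pow_ne_zero 2 htors), padicValRat.pow, padicValRat.pow,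
      padicValRat.mul (mul_ne_zero (mul_ne_zero (mul_ne_zero two_ne_zero hcQ) hs0) hkQ) hTam,
      padicValRat.mul (mul_ne_zero (mul_ne_zero two_ne_zero hcQ) hs0) hkQ,
      padicValRat.mul (mul_ne_zero two_ne_zero hcQ) hs0, padicValRat.mul two_ne_zero hcQ, h2Q]
    simp only [padicValRat.of_int, padicValRat.of_nat]
    push_cast
    ring
  rw [hvq]
  linarith [hA, hV, he]

/-- **Family core ON R**: for a value-pinned Kato family with Λ-adic lift `y` and a GIVEN Kummer logarithm `σ ≠ 0` of `proj₀ y` —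
B's rational `qSha = #Ш_an` and `v(σ) + v_p(λ/(q·R⁻_𝟙·∏P_ℓ)) + v_p φ(N) − 2 ord_p log_ω x̂ ≤ ord_p #Ш_an + ord_p Tam − 2 ord_p
#tors − 1`, from S0′ ∧ A♭-famR: the core fed with `bstwCrossingNonsplitFamilyR` at `v′ = v(σ) + v_p(λ/…) + v_p φ(N)`.
[cite: Kato2004Asterisque, Thm. 12.5 (1) (pp. 221–222), Ex. 13.3 (p. 225)] [cite: GrossZagier1986, Thm. I.(7.3)] -/
theorem valuationIneqNonsplitFamilyR_core (hA : AFlatFamStatementR) :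
    ∀ (W : WeierstrassCurve ℚ) [W.IsElliptic] [W.IsGloballyMinimal] (p : ℕ) [Fact p.Prime]
      [ContinuousSMul ℤ_[p] (W.tateModule p)] [Module.Free ℤ_[p] (W.tateModule p)] [Module.Finite ℤ_[p] (W.tateModule p)],
      ClassX11b W p → 5 ≤ p → Surj W p → ¬ W.HasSplitMultiplicativeReductionAtPrime p →
      ∀ (h1 : W.mordellWeilRank = 1) (P : Fin W.mordellWeilRank → W.toAffine.Point),
        W.IsMordellWeilBasis P →
      ∀ (K : ZpExtension ℚ p) (hK : K.IsCyclotomic) (γ : absoluteGaloisGroup ℚ)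
        (I : IwasawaH1Data W p K γ), K.IsTopGenerator γ →
      ∀ (hp : p ≠ 2) (N : ℕ) [NeZero N] (f : CuspForm (Gamma0 N) 2), IsNewformOf W f →
      ∀ (ι : (n : ℕ) → (CyclotomicField n ℚ →+* ℂ)) (q : ℚ)
        (Λ : ∀ (m : ℕ) (r : Finset (HeightOneSpectrum (𝓞 ℚ))),
          H1 (tateRep W p) (cycSubgroup p m r) →ₗ[ℤ_[p]] ℚ_[p] ⊗[ℚ] CyclotomicField (cycLevel p m r) ℚ)
        (c d₁ a : ℤ) (A : ℕ) (d' : ℤ)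
        (z : ∀ (m : ℕ) (r : (cyclotomicLevelsRat p (badPlaces c d₁ A N)).Ideals),
          H1 (tateRep W p) ((cyclotomicLevelsRat p (badPlaces c d₁ A N)).level m r.1))
        (x : ∀ (m : ℕ) (r : (cyclotomicLevelsRat p (badPlaces c d₁ A N)).Ideals),
          CyclotomicField (cycLevel p m r.1) ℚ)
        (y : I.H) (perRatio : ℚ),
        q ≠ 0 → ZetaBody W p f ι ((q : ℚ) : ℝ) Λ c d₁ a A z x →
        (∀ n : ℕ, I.proj n y =
          levelToLayer W p hK hp (badPlaces c d₁ A N) n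
            (z (n + 1) (cyclotomicLevelsRat p (badPlaces c d₁ A N)).idealOne)) →
        0 < A → Int.gcd c (6 * p * A) = 1 → Int.gcd d₁ (6 * p * N) = 1 → (d₁ : ℤ) * d' ≡ 1 [ZMOD (A : ℤ)] →
        ratCuspFactor f true c d₁ a A d' ≠ 0 → perRatio ≠ 0 →
        plusPeriod f = ((perRatio : ℚ) : ℝ) * W.realPeriodRat →
      ∀ σ : ℚ_[p], HasLocPKummerLog W p (layerZeroToTop W p K (I.proj 0 y)) σ → σ ≠ 0 →
      ∃ qSha : ℚ, shaAn W = (qSha : ℂ) ∧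
        σ.valuation +
              padicValRat p (perRatio /
                (q * ratCuspFactor f true c d₁ a A d' * ∏ ℓ ∈ A.primeFactors.erase p, eulerFactorAtOne W N ℓ)) +
              (padicValNat p (Nat.totient N) : ℤ) -
            2 * (padicLogLocal W p (WeierstrassCurve.Affine.Point.map (Algebra.ofId ℚ ℚ_[p]) (P (Fin.cast h1.symm 0)))).valuation ≤
          padicValRat p qSha + padicValNat p W.tamagawaProduct - 2 * padicValNat p W.torsionOrder - 1 := by
  intro W _ _ p _ _ _ _ hX h5 hS hns h1 P hP K hK γ I hγ hp N _ f hf ι q Λ c d₁ a A d' z x y perRatio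
    hq hzeta hy hA0 hcg hd hdd' hR hper0 hper σ hσ hσ0
  obtain ⟨-, -, -, -, -, h32, hVC, hH14, hBDP13⟩ := id hS0
  haveI hN : NeZero (W.conductorNorm ℤ) := ⟨(W.conductorNorm_pos_holds).ne'⟩
  exact valuationIneq_core_of_crossing hS0 hX h5 h1 P hP
    (σ.valuation + padicValRat p (perRatio /
      (q * ratCuspFactor f true c d₁ a A d' * ∏ ℓ ∈ A.primeFactors.erase p, eulerFactorAtOne W N ℓ)) +
      (padicValNat p (Nat.totient N) : ℤ))
    (fun L _ _ hLq hH hHp hd4 hodd hLt Dt Hd w₀ PL hPL hc hinf sB k hsB hk W' _ D hDf hmin =>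
      bstwCrossingNonsplitFamilyR h32 hVC hH14 hBDP13 hA W p hX h5 hS hns L hLq hH hHp hd4 hodd hLt Dt Hd w₀ PL hPL hc hinf
        sB k hsB hk W' D hDf hmin K hK γ I hγ hp N f hf ι q Λ c d₁ a A d' z x y perRatio hq hzeta hy hA0 hcg hd hdd' hR
        hper0 hper σ hσ hσ0)

/-- **C-sign (kernel form): the LEAD's FAMILY-LEVEL binder `hFamNonsplit` of
`ErratumRoadFiveKatoFframeValueAtomsOfFamily.valuationIneqNonsplit_of_family` (p769350) VERBATIM — ν-FREE — from S0′ ∧ A♭-famR.**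
The R family core carries `+ v_p φ(N)` on the left; `v_p φ(N) ≥ 0` is dropped (`linarith`).  So the S1R repair (booking the
Γ₁/Γ₀ Petersson index once) costs the crux NOTHING: it sits on the side of `ord_p t` and only adds slack.
[cite: Kato2004Asterisque, Thm. 12.5 (1) (pp. 221–222), Lemma 13.10 (1) (p. 230)] [cite: KingsLoefflerZerbes2017, Thm. 2.7.4] -/
theorem famValuationIneqNonsplit_of_aFlatFamR (hA : AFlatFamStatementR) :
    ∀ (W : WeierstrassCurve ℚ) [W.IsElliptic] [W.IsGloballyMinimal] (p : ℕ) [Fact p.Prime]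
      [ContinuousSMul ℤ_[p] (W.tateModule p)] [Module.Free ℤ_[p] (W.tateModule p)] [Module.Finite ℤ_[p] (W.tateModule p)],
      ClassX11b W p → 5 ≤ p → Surj W p → ¬ W.HasSplitMultiplicativeReductionAtPrime p →
      ∀ (h1 : W.mordellWeilRank = 1) (P : Fin W.mordellWeilRank → W.toAffine.Point),
        W.IsMordellWeilBasis P →
      ∀ (K : ZpExtension ℚ p) (hK : K.IsCyclotomic) (γ : absoluteGaloisGroup ℚ)
        (I : IwasawaH1Data W p K γ), K.IsTopGenerator γ →
      ∀ (hp : p ≠ 2) (N : ℕ) [NeZero N] (f : CuspForm (Gamma0 N) 2), IsNewformOf W f →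
      ∀ (ι : (n : ℕ) → (CyclotomicField n ℚ →+* ℂ)) (q : ℚ)
        (Λ : ∀ (k : ℕ) (r : Finset (HeightOneSpectrum (𝓞 ℚ))),
          H1 (tateRep W p) (cycSubgroup p k r) →ₗ[ℤ_[p]] ℚ_[p] ⊗[ℚ] CyclotomicField (cycLevel p k r) ℚ)
        (c d₁ a : ℤ) (A : ℕ) (d' : ℤ)
        (z : ∀ (k : ℕ) (r : (cyclotomicLevelsRat p (badPlaces c d₁ A N)).Ideals),
          H1 (tateRep W p) ((cyclotomicLevelsRat p (badPlaces c d₁ A N)).level k r.1))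
        (x : ∀ (k : ℕ) (r : (cyclotomicLevelsRat p (badPlaces c d₁ A N)).Ideals),
          CyclotomicField (cycLevel p k r.1) ℚ)
        (y : I.H) (perRatio : ℚ),
        q ≠ 0 → ZetaBody W p f ι ((q : ℚ) : ℝ) Λ c d₁ a A z x →
        (∀ n : ℕ, I.proj n y =
          levelToLayer W p hK hp (badPlaces c d₁ A N) n
            (z (n + 1) (cyclotomicLevelsRat p (badPlaces c d₁ A N)).idealOne)) →
        0 < A → Int.gcd c (6 * p * A) = 1 → Int.gcd d₁ (6 * p * N) = 1 → (d₁ : ℤ) * d' ≡ 1 [ZMOD (A : ℤ)] →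
        ratCuspFactor f true c d₁ a A d' ≠ 0 → perRatio ≠ 0 →
        plusPeriod f = ((perRatio : ℚ) : ℝ) * W.realPeriodRat →
      ∀ s : ℚ_[p], HasLocPKummerLog W p (layerZeroToTop W p K (I.proj 0 y)) s → s ≠ 0 →
      ∀ qSha : ℚ, shaAn W = (qSha : ℂ) →
        s.valuation +
              padicValRat p (perRatio /
                (q * ratCuspFactor f true c d₁ a A d' * ∏ ℓ ∈ A.primeFactors.erase p, eulerFactorAtOne W N ℓ)) -
            2 * (padicLogLocal W p (WeierstrassCurve.Affine.Point.map (Algebra.ofId ℚ ℚ_[p]) (P (Fin.cast h1.symm 0)))).valuation ≤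
          padicValRat p qSha + padicValNat p W.tamagawaProduct - 2 * padicValNat p W.torsionOrder - 1 := by
  intro W _ _ p _ _ _ _ hX h5 hS hns h1 P hP K hK γ I hγ hp N _ f hf ι q Λ c d₁ a A d' z x y perRatio
    hq hzeta hy hA0 hcg hd hdd' hR hper0 hper s hs hs0 qSha hqSha
  obtain ⟨q₀, hq₀, hineq⟩ := valuationIneqNonsplitFamilyR_core hS0 hA W p hX h5 hS hns h1 P hP K hK γ I hγ hp N f hf
    ι q Λ c d₁ a A d' z x y perRatio hq hzeta hy hA0 hcg hd hdd' hR hper0 hper s hs hs0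
  obtain rfl : qSha = q₀ := Rat.cast_injective (hqSha.symm.trans hq₀)
  have hν : (0 : ℤ) ≤ (padicValNat p (Nat.totient N) : ℤ) := by positivity
  linarith

/-! ## §2 Docking at route ER5's aside item BY NAME (door §6 on R): what registry r3 keys on -/

/-- **`KatoValuationIneqNonsplitAtFive` (stmt 33169) from S0′ ∧ A♭-famR, BY NAME** — through the LEAD's dock
`ErratumRoadFiveKatoFframeValueAtomsOfFamily.valuationIneqNonsplit_of_family` (the item's body is the r5.6 atom text; definitional
unfolding).  CONDITIONAL: S0′ (nine printed facts) and the OPEN `AFlatFamStatementR` are hypotheses. -/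
theorem katoValuationIneqNonsplitAtFive_of_aFlatFamR (hA : AFlatFamStatementR) :
    Summit.BirchSwinnertonDyer.BirchSwinnertonDyer.Theses.ErratumRoadFive.KatoValuationIneqNonsplitAtFive :=
  ErratumRoadFiveKatoFframeValueAtomsOfFamily.valuationIneqNonsplit_of_family (famValuationIneqNonsplit_of_aFlatFamR hS0 hA)

/-- **r3 ENTRY, MERGED road** — the crux BY NAME from S0′, S1R `BdvChainExplicitNonsplitR` and the S2R family
`∀ p ≥ 5 ∀ admissible L, EisensteinPeriodRatioValuationR L p` (the R glue `aFlatFamR_of_bdvChainR_of_calibrationR`). -/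
theorem katoValuationIneqNonsplitAtFive_of_stubsR (h₁ : BdvChainExplicitNonsplitR)
    (h₂ : ∀ (p : ℕ) [Fact p.Prime], 5 ≤ p → ∀ (L : Type) [Field L] [NumberField L],
      IsImaginaryQuadratic L → SatisfiesHeegnerHypothesis p L → NumberField.discr L < -4 →
      Odd (NumberField.discr L) → EisensteinPeriodRatioValuationR L p) :
    Summit.BirchSwinnertonDyer.BirchSwinnertonDyer.Theses.ErratumRoadFive.KatoValuationIneqNonsplitAtFive :=
  katoValuationIneqNonsplitAtFive_of_aFlatFamR hS0 (aFlatFamR_of_bdvChainR_of_calibrationR h₁ h₂)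

/-- **r3 ENTRY, PIECES road** — the crux BY NAME from S0′, S1R, the supply S2a at every admissible `(L, p)`, S2c and S2bR
(the R glue `aFlatFamR_of_bdvChainR_of_supply_of_portR`). -/
theorem katoValuationIneqNonsplitAtFive_of_piecesR (h₁ : BdvChainExplicitNonsplitR)
    (hsup : ∀ (p : ℕ) [Fact p.Prime], 5 ≤ p → ∀ (L : Type) [Field L] [NumberField L],
      IsImaginaryQuadratic L → SatisfiesHeegnerHypothesis p L → NumberField.discr L < -4 →
      Odd (NumberField.discr L) → CalibratorSupply L p)
    (hreal : CalibratorDataRealisable) (hport : BstwIntegralPerrinRiouGoodOrdinaryR) :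
    Summit.BirchSwinnertonDyer.BirchSwinnertonDyer.Theses.ErratumRoadFive.KatoValuationIneqNonsplitAtFive :=
  katoValuationIneqNonsplitAtFive_of_aFlatFamR hS0 (aFlatFamR_of_bdvChainR_of_supply_of_portR h₁ hsup hreal hport)

end Cores

end Summit.BirchSwinnertonDyer.BirchSwinnertonDyer.Theorems.ErratumRoadFiveBstwDoor

end
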